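import Summits.AtomisticToContinuum.HydrodynamicLimit.Theorems.LambertianContactSwapLambertianEulerKineticInputs
import HarnessLib

/-!
# The research inputs of the collisional log-heart: clamped collisional window large deviations under local-Gibbs restart (CCW-Λ) and collision-activity tails along `Λ` (CAT-Λ) (line `Sketch`, crux stmt-11854)

Support file (`--supports stmt-AtomisticToContinuum-11854`).  Lead c7 dissected the KINETIC log-heart into two named research
inputs (`…KineticInputs`: KCW-Λ, TL1G-Λ) and derived it (`…KineticHeartOfInputs`, p139979), leaving the COLLISIONAL log-heart
`…HeartsLog.CollisionalOneBlockInMeanLambdaLog` (P4Λ-log) undissected, with the missing fixed-`N` tools named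
(`Cruxes/LambertianEuler/Lines/Sketch.md` §c7.6: an entropy step with restart for JUMP functionals of `Λ`; the clamp bookkeeping of
the jump sum).  This file NAMES the collisional inputs so that the reduction
`CCW-Λ → CAT-Λ → TL1G-Λ → CollisionalOneBlockInMeanLambdaLog` can be kernel-checked (`…CollisionalHeartOfInputs`):

* §1 the pointwise integrands of the heart's three functionals: the collisional counter-term `Xcol` (`Xint_eq` by `rfl`) and its
  velocity clamp `XcolClamp V`; the compensated collision jump `Jcol` of the reference one-body exponent read at a post-collisional
  state (a function of its EXIT configuration `w♭ = S_{τ(w)} w`; `Jmp_eq` by `rfl`); the two-level truncation of the jump sum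
  (`trunc`: each jump at `ℓ = c_J ε_N V²`, the window sum at `L = ℓ R₀ h (N+1)^{4/3}`) and the CLAMPED COLLISIONAL WINDOW FUNCTIONAL
  `Wcol` of the gas restarted at macroscopic time `a` (truncated jump sum − clamped counter-term integral − statics `dLZ`), which is
  BOUNDED (the only form to which the entropy inequality across the noise factor applies) and whose `λ`-expectation differs from the
  heart's functional by a remainder carried by fast pairs and by collision-count overflow;
* §2 **CCW-Λ** `CollisionalClampedWindowLDLambda`: along a classical hs-Euler solution in a packing band, the log-moment-generating
  function of `−(γ/h)·Wcol` under the explicit local Gibbs reference `ψ_a` with fresh noise is `≤ γ (ϑ + A′e^{−a′V²}) (N+1)` for rates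
  `γ ≤ c₀/V`, windows `h ∈ [h₀, 2h₀] ⊆ (0, 2w₀(ϑ)]`, eventually in `N` (research; the twin of KCW-Λ — the Gaussian-in-`V` allowance
  `A′e^{−a′V²}` pays the bias of the clamps, which the kinetic clamp does not have because a radial velocity clamp keeps the
  local-Maxwellian mean of the traceless stress and of the odd heat current at zero, while the contact average of the truncated jumps
  no longer matches the one-body counter-terms exactly);
* §3 **CAT-Λ** `CollisionActivityTailsLambda`: along `Λ` from local Gibbs data, in `L¹` and in `lintegral` form (no Bochner junk),
  the clamp remainder of the jump sum over a macroscopic window — jumps above the per-contact level (fast pairs) plus the level times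
  the overflow of the window collision count above `R₀ h (N+1)^{4/3}` — is `≤ A e^{−aV²} h (N+1)` for some activity threshold `R₀`
  and level constant `c_J` of the prover's choosing, eventually in `N` (research; the Lambertian, macroscopic-window form of the
  board's `TwoClocks.TransferActivityTails`, stmt-16624).

Why the clamps are what they are (lead c8, `Lines/Sketch.md` §c8): the compensated jump of a contact `(i, j)` is
`O(ε_N (1 + |v_i|² + |v_j|²))` (gradients across the contact distance), so a per-contact truncation at `c_J ε_N V²` only removes
fast pairs; the number of contacts in a macroscopic window is unbounded, so the truncated sum is truncated once more at `R₀ ×` its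
typical size `ε_N · h (N+1)^{4/3}` — a TRUNCATION, not an indicator, so that a polynomially-rare chattering cluster cannot switch off
an extensive part of the functional (the failure mode of a global count INDICATOR: on the overflow event the one-body counter-terms
would stand uncompensated at exponential-moment level).  The counter-term `Xcol` is quadratic in the peculiar velocity and is
clamped radially like the kinetic current; its clamp remainder is paid by TL1G-Λ.

Lead prover-line-stmt-AtomisticToContinuum-11854-c8-0, 2026-08-17.  [cite: Yau1991, §2] [cite: OllaVaradhanYau1993, §3–§4]
-/

noncomputable section

namespace Summit.AtomisticToContinuum.HydrodynamicLimit.Theorems.LambertianContactSwapLambertianEulerCollisionalInputs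

open scoped BigOperators Topology ENNReal InnerProductSpace
open MeasureTheory ProbabilityTheory Filter Set InformationTheory
open Literature.MathematicalPhysics.KineticTheory
open Literature.Analysis.FluidPDE Literature.Analysis.FluidPDE.Alexander
open Summit.AtomisticToContinuum.HydrodynamicLimit.Theorems.ClampedCurrentsDockPathwise (gSum DgSum)
open Summit.AtomisticToContinuum.HydrodynamicLimit.Theorems.LambertianContactSwapLambertianEulerHearts
open Summit.AtomisticToContinuum.HydrodynamicLimit.Theorems.LambertianContactSwapLambertianEulerHeartsLog

/-! ## §1 The pointwise integrands, the truncations and the clamped collisional window functional -/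

/-- The **pointwise collisional counter-term** `X_r(x, v)` (momentum / temperature / density response of the excess pressure
`ρθ(Z − 1)`; `c = v − u_r(x)`, `η = ρ_r(x)σ³`): the integrand of the line's windowed functional `Xint` (`Xint_eq`). -/
def Xcol (σ : ℝ) (ρ θ : ℝ → T3 → ℝ) (u : ℝ → T3 → V3) (r : ℝ) (y : T3 × V3) : ℝ :=
  (∑ k : Fin 3, Literature.Analysis.FunctionSpaces.Torus.partialDeriv k (fun y' => u r y' k / θ r y') y.1) *
      (θ r y.1 * (ρ r y.1 * σ ^ 3) * deriv hsCompressibility (ρ r y.1 * σ ^ 3) +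
        (1 / 3) * (hsCompressibility (ρ r y.1 * σ ^ 3) - 1) * ‖y.2 - u r y.1‖ ^ 2) +
    ((∑ k : Fin 3, u r y.1 k * Literature.Analysis.FunctionSpaces.Torus.partialDeriv k (θ r) y.1) / (θ r y.1) ^ 2) *
      (θ r y.1 * (ρ r y.1 * σ ^ 3) * deriv hsCompressibility (ρ r y.1 * σ ^ 3) +
        (1 / 3) * (hsCompressibility (ρ r y.1 * σ ^ 3) - 1) * ‖y.2 - u r y.1‖ ^ 2) +
    (hsCompressibility (ρ r y.1 * σ ^ 3) - 1) *
      (∑ k : Fin 3, (y.2 - u r y.1) k * Literature.Analysis.FunctionSpaces.Torus.partialDeriv k (θ r) y.1) / θ r y.1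

/-- The line's windowed collisional counter-term functional IS `E_λ[∫_s^{s′} Σ_i Xcol_r((Λ_r)_i) dr]` (definitional). [folklore] -/
theorem Xint_eq (σ : ℝ) (a₀ θ₀ : T3 → ℝ) (u₀ : T3 → V3) (ρ θ : ℝ → T3 → ℝ) (u : ℝ → T3 → V3)
    (N : ℕ) (Φ : HardSphereFlow (Torus.geometry (Fin 3)) (hsDiameter σ N) (N + 1)) (s s' : ℝ) :
    Xint σ a₀ θ₀ u₀ ρ θ u N Φ s s' =
      ∫ p, (∫ r in s..s', ∑ i : Fin (N + 1), Xcol σ ρ θ u r (lambertFlow (Torus.geometry (Fin 3)) (hsDiameter σ N) p.2 p.1 r i))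
        ∂((localGibbsLaw σ a₀ u₀ θ₀ N Φ).prod (lambertNoise (Fin 3))) :=
  rfl

/-- The **velocity-clamped counter-term** `Xcol · 1{|v − u_r(x)| ≤ V}`. -/
def XcolClamp (V : ℝ) (σ : ℝ) (ρ θ : ℝ → T3 → ℝ) (u : ℝ → T3 → V3) (r : ℝ) (y : T3 × V3) : ℝ :=
  if ‖y.2 - u r y.1‖ ≤ V then Xcol σ ρ θ u r y else 0

/-- The **compensated collision jump** of the reference one-body exponent `Σ_i g_t` (`gSum` along `a = ρ·Rf(σ³ρ)`) read at a
post-collisional state `w` of the Lambertian recursion: the noise-averaged jump at the Lambertian redraw of the incoming pair of the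
EXIT configuration `w♭ = S_{τ(w)} w`, `E_ξ[Σ_i g_t(redraw of w♭)] − Σ_i g_t(w♭)` — the summand of the line's `Jmp` (`Jmp_eq`).  A
function of `w` through `w♭` only. -/
def Jcol (σ : ℝ) (Rf : ℝ → ℝ) (ρ θ : ℝ → T3 → ℝ) (u : ℝ → T3 → V3) (N : ℕ) (t : ℝ)
    (w : Config (N + 1) (Fin 3) T3) : ℝ :=
  (∫ ξ, gSum (fun r x => ρ r x * Rf (σ ^ 3 * ρ r x)) θ u t
      (lambertStepMap (Torus.geometry (Fin 3)) (incomingPairs (Torus.geometry (Fin 3)) (hsDiameter σ N)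
        (freeFlight (Torus.geometry (Fin 3)) (freeExitTime (Torus.geometry (Fin 3)) (hsDiameter σ N) w).toReal w))
        (freeFlight (Torus.geometry (Fin 3)) (freeExitTime (Torus.geometry (Fin 3)) (hsDiameter σ N) w).toReal w) ξ)
      ∂(stdGaussian V3)) -
    gSum (fun r x => ρ r x * Rf (σ ^ 3 * ρ r x)) θ u t
      (freeFlight (Torus.geometry (Fin 3)) (freeExitTime (Torus.geometry (Fin 3)) (hsDiameter σ N) w).toReal w)

/-- The line's windowed collision functional IS `E_λ[Σ_{m<K_{s′}, s<t_{m+1}} Jcol_{t_{m+1}}(z_m)]` (definitional). [folklore] -/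
theorem Jmp_eq (σ : ℝ) (a₀ θ₀ : T3 → ℝ) (u₀ : T3 → V3) (Rf : ℝ → ℝ) (ρ θ : ℝ → T3 → ℝ) (u : ℝ → T3 → V3)
    (N : ℕ) (Φ : HardSphereFlow (Torus.geometry (Fin 3)) (hsDiameter σ N) (N + 1)) (s s' : ℝ) :
    Jmp σ a₀ θ₀ u₀ Rf ρ θ u N Φ s s' =
      ∫ p, (∑ m ∈ Finset.range (lambertCount (Torus.geometry (Fin 3)) (hsDiameter σ N) p.2 p.1 s'),
          if s < (lambertInstant (Torus.geometry (Fin 3)) (hsDiameter σ N) p.2 p.1 (m + 1)).toReal then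
            Jcol σ Rf ρ θ u N (lambertInstant (Torus.geometry (Fin 3)) (hsDiameter σ N) p.2 p.1 (m + 1)).toReal
              (lambertStateAfter (Torus.geometry (Fin 3)) (hsDiameter σ N) p.2 p.1 m)
          else 0) ∂((localGibbsLaw σ a₀ u₀ θ₀ N Φ).prod (lambertNoise (Fin 3))) :=
  rfl

/-- Symmetric truncation at level `ℓ`: `trunc ℓ x = max (−ℓ) (min ℓ x)`. [folklore] -/
def trunc (ℓ x : ℝ) : ℝ :=
  max (-ℓ) (min ℓ x)

/-- The per-contact truncation level `ℓ = c_J ε_N V²` (`ε_N = hsDiameter σ N`). -/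
def jumpLevel (σ : ℝ) (N : ℕ) (cJ V : ℝ) : ℝ :=
  cJ * hsDiameter σ N * V ^ 2

/-- The window truncation level `L = ℓ · R₀ h (N+1)^{4/3}` (`R₀ ×` the typical number of contacts in a window of length `h`, times the
per-contact level). -/
def sumLevel (σ : ℝ) (N : ℕ) (cJ V R₀ h : ℝ) : ℝ :=
  jumpLevel σ N cJ V * (R₀ * h * ((N : ℝ) + 1) ^ (4 / 3 : ℝ))

/-- **The clamped collisional window functional of the restarted gas.**  For the Lambertian gas started at `q = (w, ηs)` and read
against the profiles from macroscopic time `a` on, over the window `(0, h]`: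
`Wcol = trunc_L (Σ_{m<K_h, 0<t_{m+1}} trunc_ℓ Jcol_{a+t_{m+1}}(w_m)) − ∫_0^h Σ_i XcolClamp V (a+r′) ((Λ_{r′})_i) dr′ − dLZ(a, a+h)`,
`ℓ = jumpLevel`, `L = sumLevel`.  Bounded; its `λ`-side expectation over a window `(a, a+h]` of one trajectory is the restart of the
same expression (jump restart + `integral_window_restart`), and `−E_λ[·]` is the clamped part of the heart's `−Jmp + Xint + dLZ`. -/
def Wcol (σ : ℝ) (Rf : ℝ → ℝ) (ρ θ : ℝ → T3 → ℝ) (u : ℝ → T3 → V3) (N : ℕ) (V cJ R₀ a h : ℝ)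
    (q : Config (N + 1) (Fin 3) T3 × (ℕ → V3)) : ℝ :=
  trunc (sumLevel σ N cJ V R₀ h)
      (∑ m ∈ Finset.range (lambertCount (Torus.geometry (Fin 3)) (hsDiameter σ N) q.2 q.1 h),
        if 0 < (lambertInstant (Torus.geometry (Fin 3)) (hsDiameter σ N) q.2 q.1 (m + 1)).toReal then
          trunc (jumpLevel σ N cJ V)
            (Jcol σ Rf ρ θ u N (a + (lambertInstant (Torus.geometry (Fin 3)) (hsDiameter σ N) q.2 q.1 (m + 1)).toReal)
              (lambertStateAfter (Torus.geometry (Fin 3)) (hsDiameter σ N) q.2 q.1 m))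
        else 0) -
    (∫ r' in (0 : ℝ)..h, ∑ i : Fin (N + 1),
      XcolClamp V σ ρ θ u (a + r') (lambertFlow (Torus.geometry (Fin 3)) (hsDiameter σ N) q.2 q.1 r' i)) -
    dLZ σ Rf ρ N a (a + h)

/-! ## §2 CCW-Λ — clamped collisional window large deviations under local-Gibbs restart -/

/-- **CCW-Λ — `CollisionalClampedWindowLDLambda`** (research input of the collisional log-heart).  For every insertion factor
`(r, Rf)` there is a band `ηc > 0` and `σ₀ > 0` such that for `0 < σ < σ₀`, every classical hs-Euler solution `(ρ,u,θ)` on `[0,T)`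
with packing `< ηc`, every flow family `Φ` (phase spaces) and `t ∈ (0,T)`, and for every overflow factor `R₀ ≥ 1` and level constant
`c_J > 0`: there are a rate scale `c₀ > 0` and a Gaussian bias allowance `A′, a′ > 0` such that for every clamp level `V ≥ 1`, every
rate `0 < γ ≤ c₀/V` and every `ϑ > 0` there is `w₀ > 0` such that for every `0 < h₀ ≤ w₀`, eventually in `N`, for all windows
`[a, a+h] ⊆ [0,t]` with `h₀ ≤ h ≤ 2h₀`:
`log ∫ exp(−(γ/h) · Wcol σ Rf ρ θ u N V c_J R₀ a h (q)) d(ψ_a ⊗ γ^ℕ)(q) ≤ γ (ϑ + A′ e^{−a′V²}) (N+1)`,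
`ψ_a = localGibbsLaw σ (ρ_a·Rf(σ³ρ_a)) u_a θ_a` — the exponential moment, at a rate fixed per clamp level, of the clamped collisional
window functional (truncated compensated jumps of the reference exponent at the contacts of the window, minus the clamped one-body
counter-terms, minus the statics) of `Λ` RESTARTED FROM THE REFERENCE with fresh noise is sub-extensive up to the Gaussian-in-`V`
bias of the clamps.  Heuristics: under the reference start the contact statistics are those of local equilibrium up to `o(h) + O(Kn)`,
for which the compensated jumps are balanced by the counter-terms and `dLZ` (the cancellation that typed `X`); the fluctuation term is
`O(γ τ_free/h) → 0` because each contact redraws the pair's relative direction afresh; the cap `γ ≤ c₀/V` (with `c₀` small given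
`c_J`, `σ`, the profiles) is the static Gaussian saddle of a particle of speed `U`: `≍ U h (N+1)^{1/3}` contacts in the window, each
truncated jump `≤ c_J ε_N V²`, against the Maxwellian cost `U²/(2θ)`.  OPEN — a research statement of this line, not a published
fact. -/
def CollisionalClampedWindowLDLambda : Prop :=
  ∀ (r : ℝ) (Rf : ℝ → ℝ), 0 < r →
      (∀ x ∈ Set.Ioo (-r) r, 0 < Rf x ∧ Rf x * (∑' j : ℕ, bE j / (j.factorial : ℝ) * (x * Rf x) ^ j) = 1) →
      (∀ x ∈ Set.Icc 0 r, 1 ≤ Rf x ∧ Rf x ≤ 2) → ContinuousOn Rf (Set.Icc 0 r) →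
      (∀ x ∈ Set.Ioo (-r) r, ∀ R ∈ Set.Icc (1 / 2 : ℝ) 2,
        R * (∑' j : ℕ, bE j / (j.factorial : ℝ) * (x * R) ^ j) = 1 → R = Rf x) →
    ∃ ηc : ℝ, 0 < ηc ∧ ∃ σ₀ : ℝ, 0 < σ₀ ∧ ∀ σ : ℝ, 0 < σ → σ < σ₀ →
      ∀ (T : ℝ) (ρ θ : ℝ → T3 → ℝ) (u : ℝ → T3 → V3), IsHardSphereEulerSolution σ T ρ u θ →
        (∀ t ∈ Set.Ico 0 T, ∀ x, ρ t x * σ ^ 3 < ηc) →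
        ∀ Φ : (N : ℕ) → HardSphereFlow (Torus.geometry (Fin 3)) (hsDiameter σ N) (N + 1),
          ∀ t ∈ Set.Ioo 0 T, ∀ R₀ : ℝ, 1 ≤ R₀ → ∀ cJ : ℝ, 0 < cJ →
            ∃ c₀ A' a' : ℝ, 0 < c₀ ∧ 0 < A' ∧ 0 < a' ∧ ∀ V : ℝ, 1 ≤ V → ∀ γ : ℝ, 0 < γ → γ ≤ c₀ / V →
            ∀ ϑ : ℝ, 0 < ϑ → ∃ w₀ : ℝ, 0 < w₀ ∧ ∀ h₀ : ℝ, 0 < h₀ → h₀ ≤ w₀ → ∃ N₀ : ℕ, ∀ N : ℕ, N₀ ≤ N →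
              ∀ (a h : ℝ), 0 ≤ a → h₀ ≤ h → h ≤ 2 * h₀ → a + h ≤ t →
                Real.log (∫ q, Real.exp (-((γ / h) * Wcol σ Rf ρ θ u N V cJ R₀ a h q))
                  ∂((localGibbsLaw σ (fun x => ρ a x * Rf (σ ^ 3 * ρ a x)) (u a) (θ a) N (Φ N)).prod
                    (lambertNoise (Fin 3)))) ≤ γ * (ϑ + A' * Real.exp (-(a' * V ^ 2))) * ((N : ℝ) + 1)

/-! ## §3 CAT-Λ — collision-activity tails along `Λ` -/

/-- **CAT-Λ — `CollisionActivityTailsLambda`** (research input of the collisional log-heart).  For every insertion factor `(r, Rf)`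
there is a band `ηt > 0` such that for continuous positive data profiles there is `σ₀ > 0` such that for `0 < σ < σ₀`, every
classical hs-Euler solution with packing `< ηt`, every flow family tied at `t = 0` and `t ∈ (0,T)`: there are an overflow factor
`R₀ ≥ 1`, a level constant `c_J > 0` and `A, a > 0` such that for every `V ≥ 1` and `h₀ ∈ (0, t]`… (`0 < h₀`), eventually in `N`, for
all windows `[a, a+h] ⊆ [0,t]` with `h₀ ≤ h ≤ 2h₀`, along `Λ` under `λ_N ⊗ γ^ℕ`:
`E[Σ_{m<K_{a+h}, a<t_{m+1}} (|Jcol_{t_{m+1}}(z_m)| − c_J ε_N V²)₊] + E[(c_J ε_N V² · (K_{a+h} − K_a − R₀ h (N+1)^{4/3}))₊]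
≤ A e^{−aV²} h (N+1)` (both expectations as `lintegral`s of `ENNReal.ofReal`) — the clamp remainder of the jump sum: contacts whose
compensated jump exceeds the per-contact level (`|Jcol| ≤ C ε_N (1 + |v_i|² + |v_j|²)`, so: fast pairs) and the overflow of the
window collision count above `R₀ ×` its typical size, weighted by the level, are Gaussian-small in `V`, in `L¹`, uniformly over
macroscopic windows.  Expected TRUE (bounded pre-shock profiles bound the local contact rates; a particle with `≫ h(N+1)^{1/3}`
contacts in a window, or a window with `≫ h(N+1)^{4/3}` contacts, is super-exponentially rare under the Lambertian redraws, and
chattering clusters are polynomially rare with `O(1)` contacts each), but dynamical: an a-priori bound on collision frequencies under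
the non-equilibrium law.  The Lambertian, macroscopic-window form of the board's `TwoClocks.TransferActivityTails` (stmt-16624).
OPEN — a research statement of this line, not a published fact. -/
def CollisionActivityTailsLambda : Prop :=
  ∀ (r : ℝ) (Rf : ℝ → ℝ), 0 < r →
      (∀ x ∈ Set.Ioo (-r) r, 0 < Rf x ∧ Rf x * (∑' j : ℕ, bE j / (j.factorial : ℝ) * (x * Rf x) ^ j) = 1) →
      (∀ x ∈ Set.Icc 0 r, 1 ≤ Rf x ∧ Rf x ≤ 2) → ContinuousOn Rf (Set.Icc 0 r) →
      (∀ x ∈ Set.Ioo (-r) r, ∀ R ∈ Set.Icc (1 / 2 : ℝ) 2,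
        R * (∑' j : ℕ, bE j / (j.factorial : ℝ) * (x * R) ^ j) = 1 → R = Rf x) →
    ∃ ηt : ℝ, 0 < ηt ∧ ∀ (a₀ θ₀ : T3 → ℝ) (u₀ : T3 → V3), Continuous a₀ → Continuous θ₀ → Continuous u₀ →
      (∀ x, 0 < a₀ x) → (∀ x, 0 < θ₀ x) →
      ∃ σ₀ : ℝ, 0 < σ₀ ∧ ∀ σ : ℝ, 0 < σ → σ < σ₀ →
        ∀ (T : ℝ) (ρ θ : ℝ → T3 → ℝ) (u : ℝ → T3 → V3), IsHardSphereEulerSolution σ T ρ u θ →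
          (∀ t ∈ Set.Ico 0 T, ∀ x, ρ t x * σ ^ 3 < ηt) →
          ∀ Φ : (N : ℕ) → HardSphereFlow (Torus.geometry (Fin 3)) (hsDiameter σ N) (N + 1),
            TendstoHydroFieldsAt (fun N => localGibbsLaw σ a₀ u₀ θ₀ N (Φ N)) Φ ρ u θ 0 →
            ∀ t ∈ Set.Ioo 0 T, ∃ R₀ cJ A a : ℝ, 1 ≤ R₀ ∧ 0 < cJ ∧ 0 < A ∧ 0 < a ∧
              ∀ V : ℝ, 1 ≤ V → ∀ h₀ : ℝ, 0 < h₀ → ∃ N₀ : ℕ, ∀ N : ℕ, N₀ ≤ N →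
                ∀ (a' h : ℝ), 0 ≤ a' → h₀ ≤ h → h ≤ 2 * h₀ → a' + h ≤ t →
                  (∫⁻ p, ENNReal.ofReal
                      (∑ m ∈ Finset.range (lambertCount (Torus.geometry (Fin 3)) (hsDiameter σ N) p.2 p.1 (a' + h)),
                        if a' < (lambertInstant (Torus.geometry (Fin 3)) (hsDiameter σ N) p.2 p.1 (m + 1)).toReal then
                          max (|Jcol σ Rf ρ θ u N
                              (lambertInstant (Torus.geometry (Fin 3)) (hsDiameter σ N) p.2 p.1 (m + 1)).toReal
                              (lambertStateAfter (Torus.geometry (Fin 3)) (hsDiameter σ N) p.2 p.1 m)| -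
                            jumpLevel σ N cJ V) 0
                        else 0)
                    ∂((localGibbsLaw σ a₀ u₀ θ₀ N (Φ N)).prod (lambertNoise (Fin 3)))) +
                  (∫⁻ p, ENNReal.ofReal (jumpLevel σ N cJ V *
                      (((lambertCount (Torus.geometry (Fin 3)) (hsDiameter σ N) p.2 p.1 (a' + h) : ℕ) : ℝ) -
                        ((lambertCount (Torus.geometry (Fin 3)) (hsDiameter σ N) p.2 p.1 a' : ℕ) : ℝ) -
                        R₀ * h * ((N : ℝ) + 1) ^ (4 / 3 : ℝ)))
                    ∂((localGibbsLaw σ a₀ u₀ θ₀ N (Φ N)).prod (lambertNoise (Fin 3)))) ≤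
                  ENNReal.ofReal (A * Real.exp (-(a * V ^ 2)) * h * ((N : ℝ) + 1))

/-! ## §4 Elementary facts about the truncations (registered sub-goals `abs_trunc_le`, `abs_sub_trunc_eq`) -/

/-- `|max (−ℓ) (min ℓ x)| ≤ ℓ` for `ℓ ≥ 0` (registered sub-goal, raw form of the truncation). [folklore] -/
theorem abs_trunc_le : ∀ {ℓ : ℝ}, 0 ≤ ℓ → ∀ x : ℝ, |max (-ℓ) (min ℓ x)| ≤ ℓ := by
  intro ℓ hℓ x
  rw [abs_le]
  exact ⟨le_max_left _ _, max_le (by linarith) (min_le_left _ _)⟩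

/-- `|trunc ℓ x| ≤ ℓ` for `ℓ ≥ 0`. [folklore] -/
theorem abs_trunc_le' {ℓ : ℝ} (hℓ : 0 ≤ ℓ) (x : ℝ) : |trunc ℓ x| ≤ ℓ :=
  abs_trunc_le hℓ x

/-- `|trunc ℓ x| ≤ |x|` for `ℓ ≥ 0`. [folklore] -/
theorem abs_trunc_le_abs {ℓ : ℝ} (hℓ : 0 ≤ ℓ) (x : ℝ) : |trunc ℓ x| ≤ |x| := by
  unfold trunc
  rcases le_total x ℓ with h | h
  · rw [min_eq_right h]
    rcases le_total (-ℓ) x with h' | h'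
    · rw [max_eq_right h']
    · rw [max_eq_left h', abs_of_nonpos (by linarith), abs_of_nonpos (by linarith)]
      linarith
  · rw [min_eq_left h, max_eq_right (by linarith), abs_of_nonneg hℓ]
    exact h.trans (le_abs_self x)

/-- The truncation error is the excess: `|x − max (−ℓ) (min ℓ x)| = (|x| − ℓ)₊` for `ℓ ≥ 0` (registered sub-goal, raw form).
[folklore] -/
theorem abs_sub_trunc_eq : ∀ {ℓ : ℝ}, 0 ≤ ℓ → ∀ x : ℝ, |x - max (-ℓ) (min ℓ x)| = max (|x| - ℓ) 0 := by
  intro ℓ hℓ x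
  rcases le_total x ℓ with h | h
  · rw [min_eq_right h]
    rcases le_total (-ℓ) x with h' | h'
    · rw [max_eq_right h', sub_self, abs_zero, max_eq_right]
      rw [sub_nonpos, abs_le]; exact ⟨h', h⟩
    · rw [max_eq_left h', abs_of_nonpos (a := x) (by linarith), max_eq_left (by linarith),
        abs_of_nonpos (a := x - -ℓ) (by linarith)]
      ring
  · rw [min_eq_left h, max_eq_right (by linarith), abs_of_nonneg (a := x) (by linarith), max_eq_left (by linarith),
      abs_of_nonneg (by linarith)]

/-- `|x − trunc ℓ x| = (|x| − ℓ)₊` for `ℓ ≥ 0`. [folklore] -/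
theorem abs_sub_trunc_eq' {ℓ : ℝ} (hℓ : 0 ≤ ℓ) (x : ℝ) : |x - trunc ℓ x| = max (|x| - ℓ) 0 :=
  abs_sub_trunc_eq hℓ x

/-- `trunc ℓ` is `1`-Lipschitz: `|trunc ℓ x − trunc ℓ y| ≤ |x − y|`. [folklore] -/
theorem abs_trunc_sub_trunc_le (ℓ x y : ℝ) : |trunc ℓ x - trunc ℓ y| ≤ |x - y| := by
  unfold trunc
  have h1 : |min ℓ x - min ℓ y| ≤ |x - y| := abs_min_sub_min_le_max _ _ _ _ |>.trans (by
    rw [sub_self, abs_zero, max_eq_right (abs_nonneg _)])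
  exact (abs_max_sub_max_le_max _ _ _ _).trans (by rw [sub_self, abs_zero, max_eq_right (abs_nonneg _)]; exact h1)

end Summit.AtomisticToContinuum.HydrodynamicLimit.Theorems.LambertianContactSwapLambertianEulerCollisionalInputs
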